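import Mathlib
import Summits.ResolutionOfSingularities.ResolutionOfSingularities.Theorems.RadicialJungCleanModelsContactChainClean
import Literature.AlgebraicGeometry.Resolution.RegularWeakTransformPrime
import HarnessLib

/-!
# Route `RadicialJung`, crux `CleanModels` (stmt-ResolutionOfSingularities-15917), line `Sketch` rev 35, stub 6 `stub_cleanProp44` (X44c),
# work plan O8 / L7b: clean components CONTAINING the curve along a chain of point blowing ups, mixed with transversal ones

`Theorems/RadicialJungCleanModelsContactChainClean.lean` (✓ p693282) lists as NOT done: «components containing the curve».  Setting: `X₀`
regular locally Noetherian, `C₀` a regular curve through the closed point `x₀` (`dim 𝒪_{X₀,x₀} = 3`), `𝓘_{C₀,x₀} = (t₁, t₂)` with `(t₁, t₂)` part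
of a regular system of parameters (the two clean components CONTAINING the curve, exponents `α₁, α₂`, possibly `0`), `w` a transversal
coordinate and `s_i = γ_i w^{k_i} + s₀ᵢ` further clean components NOT containing the curve (contact normal forms, exponents `a_i`).

* `isRsopPart_of_span_eq_span` — two pairs generating the same ideal, one of them part of a regular system of parameters: so is the other.
* `containing_pair_step` — ONE point blowing up `π` at `x = π c'`, `c'` the point of the strict transform `C̃` over `x`: if `(t₁, t₂)` generates
  `𝓘_{C,x}` then `π^#(t_j) = e · t_j'` with `(e) = 𝓘_E 𝒪_{X',c'}` and `(t₁', t₂')` a pair, part of a regular system of parameters of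
  `𝒪_{X',c'}`, GENERATING `𝓘_{C̃,c'}`.  The input is the EQUALITY `𝓘_C 𝒪_{X'} = 𝓘_E · 𝓘_{C̃}` — the tree's
  `IsBlowup.strictTransformIdeal_eq_controlledTransform_of_isRegular_subscheme` (weak = strict transform for the regular pair `{x} ⊆ C`,
  `RegularWeakTransformPrime.lean`) with `IsBlowup.pow_mul_controlledTransform_eq` and `vanishingIdeal_closure_eq_strictTransformIdeal_of_transverse`
  — read in the stalk, plus cancellation of the regular element `e`.
* `contact_family_pair_along_pointChain` — along a chain of `n` point blowing ups following the curve (`IsPointChainAlong`): ONE exceptional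
  coordinate `e` at the end point `x`, transversal to the strict transform `C`; the containing pair becomes `σ^#(t_j) = c_j · e^n · t_j⁽ⁿ⁾` with
  `(t₁⁽ⁿ⁾, t₂⁽ⁿ⁾)` part of a regular system of parameters generating `𝓘_{C,x}`; and every transversal member becomes
  `σ^#(s_i) = c_i · e^{min(n,k_i)} · (γ_i' e^{k_i − n} + π_i')` (as in `contact_along_pointChain`, any length `n`).
* `cleanPermissibleAt_of_pointChain_containing` — **L7b with containing components**: if the line of `G` at `x₀` is presented as
  `Σ_j c_j^p G^j = u₀ · t₁^{α₁} t₂^{α₂} · ∏_i s_i^{a_i}` and the chain has length `n ≥ max_i k_i`, then at `x` the line of `σ^♯ G` is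
  `(unit) · (t₁⁽ⁿ⁾)^{α₁} (t₂⁽ⁿ⁾)^{α₂} · e^{n(α₁+α₂) + Σ_i k_i a_i}` in coordinates ADAPTED to `C`, hence clean-permissible for the centre `C`
  (`cleanPermissibleAt_of_split`, ✓ p685976) as soon as SOME `α_j` is prime to `p` — no charge condition on the landing — or the landing is
  charged, `p ∤ n(α₁+α₂) + Σ_i k_i a_i`.
What is still NOT here (rest of O8): the uncharged landing with `p ∣ α₁, α₂` (form (2) is ✓ `cleanPermissibleAt_of_unit`; form (3) restarts).

Honest framing: OURS (elementary local algebra of point blowing ups; [CJS 2020] proof of Thm. 6.28 Step 5 / [CoP1] p. 10); nothing here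
proves resolution in characteristic `p`, X44c, or any case of `CleanModels`.
-/

noncomputable section

set_option linter.dupNamespace false -- mandated namespace of this single-conjunct summit

open CategoryTheory AlgebraicGeometry TopologicalSpace IsLocalRing
open Literature.AlgebraicGeometry.Resolution Literature.AlgebraicGeometry.Motives
open Scheme.IdealSheafData

universe u

namespace Summit.ResolutionOfSingularities.ResolutionOfSingularities.Theorems.RadicialJung.CleanModels

/-- Two families of the same length generating the same ideal: if one is part of a regular system of parameters, so is the other
(complete by the same complementary family). [cite: Matsumura1987, Thm. 14.2] -/
theorem isRsopPart_of_span_eq_span {R : Type u} [CommRing R] [IsLocalRing R] {n : ℕ} {c t : Fin n → R} {J : Ideal R}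
    (hc : IsRsopPart c) (hcJ : Ideal.span (Set.range c) = J) (htJ : Ideal.span (Set.range t) = J) : IsRsopPart t := by
  obtain ⟨hR, e, y, hdim, hspan⟩ := hc
  refine ⟨hR, e, y, hdim, ?_⟩
  rw [Ideal.span_union] at hspan ⊢
  rw [htJ, ← hcJ]
  exact hspan

/-- Two generators of the same principal ideal of a regular local ring differ by a unit (a regular local ring is a domain,
Matsumura Thm. 14.3); local copy of the lemma of `…ContactChainFamily.lean`. [cite: Matsumura1987, Thm. 14.3] -/
private theorem exists_isUnit_mul_eq_of_span_singleton_eq' {R : Type u} [CommRing R] [IsRegularLocalRing R] {a b : R}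
    (h : Ideal.span ({a} : Set R) = Ideal.span {b}) : ∃ d : R, IsUnit d ∧ a = d * b := by
  haveI := isDomain_of_isRegularLocalRing R
  obtain ⟨u, hu⟩ := (Ideal.span_singleton_eq_span_singleton.mp h).symm
  exact ⟨(u : R), u.isUnit, by rw [← hu, mul_comm]⟩

/-- **One point blowing up: the pair of clean components containing the curve.**  See the module docstring.
[cite: GortzWedhorn2020, Prop. 13.96 (2)] [cite: CossartPiltant2008, Prop. 4.4 (proof, p. 10)] -/
theorem containing_pair_step {X X' : Scheme.{u}} [IsLocallyNoetherian X] [IsLocallyNoetherian X'] {π : X' ⟶ X}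
    (hX : Scheme.IsRegular X) {c' : X'} (hx : IsClosed ({π c'} : Set X))
    (hYreg : Scheme.IsRegular (vanishingIdeal (⟨{π c'}, hx⟩ : Closeds X)).subscheme)
    (hπ : IsBlowup π (vanishingIdeal (⟨{π c'}, hx⟩ : Closeds X))) {C : Closeds X}
    (hCreg : ∀ y ∈ (C : Set X), ∃ c : Fin 2 → X.presheaf.stalk y,
      IsRsopPart c ∧ Ideal.span (Set.range c) = stalkIdeal (vanishingIdeal C) y)
    (hxC : π c' ∈ (C : Set X)) (hdim : ringKrullDim (X.presheaf.stalk (π c')) = 3)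
    (hc' : c' ∈ closure (π ⁻¹' ((C : Set X) \ {π c'})))
    (t : Fin 2 → X.presheaf.stalk (π c')) (htP : Ideal.span (Set.range t) = stalkIdeal (vanishingIdeal C) (π c')) :
    ∃ e : X'.presheaf.stalk c',
      stalkIdeal ((vanishingIdeal (⟨{π c'}, hx⟩ : Closeds X)).comap π) c' = Ideal.span {e} ∧
      ∃ t' : Fin 2 → X'.presheaf.stalk c', IsRsopPart t' ∧
        Ideal.span (Set.range t') =
          stalkIdeal (vanishingIdeal (⟨closure (π ⁻¹' ((C : Set X) \ {π c'})), isClosed_closure⟩ : Closeds X')) c' ∧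
        ∀ i, (π.stalkMap c').hom (t i) = e * t' i := by
  set Y : Closeds X := ⟨{π c'}, hx⟩
  set Ct : Closeds X' := ⟨closure (π ⁻¹' ((C : Set X) \ {π c'})), isClosed_closure⟩
  -- transversality of `C` and `Y = {x}` at `x`, and the dimension hypothesis, in the form the tree lemmas want
  have hPle : stalkIdeal (vanishingIdeal C) (π c') ≤ maximalIdeal _ :=
    (mem_support_iff_stalkIdeal_le _ _).mp
      (by rw [← SetLike.mem_coe, Scheme.IdealSheafData.coe_support_vanishingIdeal]; exact hxC)
  have htr : ∀ y ∈ (C : Set X) ∩ Y, stalkIdeal (vanishingIdeal C) y ⊔ stalkIdeal (vanishingIdeal Y) y = maximalIdeal _ := by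
    rintro y ⟨-, hy⟩
    have hy' : y = π c' := hy
    subst hy'
    rw [stalkIdeal_vanishingIdeal_singleton hx]
    exact sup_eq_right.mpr hPle
  have hdim' : ∀ y ∈ (C : Set X) ∩ Y, ringKrullDim (X.presheaf.stalk y) = 3 := by
    rintro y ⟨-, hy⟩
    have hy' : y = π c' := hy
    subst hy'
    exact hdim
  -- the strict transform and its regular pair of generators at `c'`
  have hIeq : vanishingIdeal Ct = strictTransformIdeal π (vanishingIdeal Y) (vanishingIdeal C) :=
    (vanishingIdeal_closure_eq_strictTransformIdeal_of_transverse hπ hCreg htr hdim').1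
  obtain ⟨c2, hc2, hc2span⟩ := (exists_isRsopPart_strictTransform_of_transverse hπ hCreg htr hdim' hX hYreg hc').1
  haveI : IsRegularLocalRing (X'.presheaf.stalk c') := hc2.isRegularLocalRing
  haveI := isDomain_of_isRegularLocalRing (X'.presheaf.stalk c')
  -- the exceptional ideal is principal at `c'`, generated by a regular element `e`
  obtain ⟨e, he0, he⟩ := hπ.isEffectiveCartier.exists_stalkIdeal_eq_span c'
  have he0' : e ≠ 0 := nonZeroDivisors.ne_zero he0
  set φ := (π.stalkMap c').hom with hφ
  set P := stalkIdeal (vanishingIdeal C) (π c') with hP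
  set P' := stalkIdeal (vanishingIdeal Ct) c' with hP'
  -- `𝓘_C 𝒪' = e · 𝓘_{C̃}`: weak = strict transform for the regular pair `{x} ⊆ C`
  have hKreg : Scheme.IsRegular (vanishingIdeal C).subscheme :=
    isRegular_subscheme_vanishingIdeal_of_forall_isRsopPart fun z hz => by
      obtain ⟨c, hc, h⟩ := hCreg z hz
      exact ⟨2, c, hc, h⟩
  have hCY : vanishingIdeal C ≤ vanishingIdeal Y :=
    vanishingIdeal_antimono (fun z hz => by have hz' : z = π c' := hz; subst hz'; exact hxC)
  have hle1 : (vanishingIdeal C).comap π ≤ (vanishingIdeal Y).comap π ^ 1 := by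
    rw [pow_one]; exact comap_mono _ hCY
  have hprod := hπ.pow_mul_controlledTransform_eq hle1
  have hsw := hπ.strictTransformIdeal_eq_controlledTransform_of_isRegular_subscheme hX hYreg hCY hKreg
  have hfac : (vanishingIdeal C).comap π = (vanishingIdeal Y).comap π * vanishingIdeal Ct := by
    rw [hIeq, hsw, ← hprod, pow_one]
  have hPP' : P.map φ = Ideal.span {e} * P' := by
    calc P.map φ = stalkIdeal ((vanishingIdeal C).comap π) c' := by rw [hP, hφ, stalkIdeal_comap_eq_map_stalkMap]
      _ = stalkIdeal ((vanishingIdeal Y).comap π * vanishingIdeal Ct) c' := by rw [hfac]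
      _ = Ideal.span {e} * P' := by rw [stalkIdeal_mul, he, hP']
  -- each generator: `φ (t i) = e · t'_i` with `t'_i ∈ 𝓘_{C̃,c'}`
  have hmem : ∀ i, ∃ t'i ∈ P', e * t'i = φ (t i) := fun i =>
    Ideal.mem_span_singleton_mul.mp (by
      rw [← hPP']
      exact Ideal.mem_map_of_mem _ (by rw [← htP]; exact Ideal.subset_span ⟨i, rfl⟩))
  choose t' ht'P ht'eq using hmem
  -- the new pair generates `𝓘_{C̃,c'}` (cancel `e`)
  have hspan' : Ideal.span (Set.range t') = P' := by
    apply le_antisymm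
    · exact Ideal.span_le.mpr (by rintro _ ⟨i, rfl⟩; exact ht'P i)
    · intro y hy
      have h1 : e * y ∈ P.map φ := by
        rw [hPP']; exact Ideal.mul_mem_mul (Ideal.mem_span_singleton_self e) hy
      have h2 : P.map φ ≤ Ideal.span {e} * Ideal.span (Set.range t') := by
        rw [← htP, Ideal.map_span]
        refine Ideal.span_le.mpr ?_
        rintro _ ⟨_, ⟨i, rfl⟩, rfl⟩
        rw [← ht'eq i]
        exact Ideal.mul_mem_mul (Ideal.mem_span_singleton_self e) (Ideal.subset_span ⟨i, rfl⟩)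
      obtain ⟨z, hz, hez⟩ := Ideal.mem_span_singleton_mul.mp (h2 h1)
      have hzy : z = y := mul_left_cancel₀ he0' hez
      rw [← hzy]
      exact hz
  exact ⟨e, he, t', isRsopPart_of_span_eq_span hc2 hc2span hspan', hspan', fun i => (ht'eq i).symm⟩

/-- **Containing pair and transversal family along one chain of point blowing ups.**  See the module docstring.
[cite: CossartJannsenSaito2020, proof of Thm. 6.28, Step 5] [cite: CossartPiltant2008, Prop. 4.4 (proof, p. 10)] -/
theorem contact_family_pair_along_pointChain {X₀ X : Scheme.{u}} {σ : X ⟶ X₀} {C₀ : Closeds X₀} {C : Closeds X} {x : X} {n : ℕ}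
    (h : IsPointChainAlong σ C₀ C x n) [IsLocallyNoetherian X₀] [IsLocallyNoetherian X] (hX₀ : Scheme.IsRegular X₀)
    (hC₀reg : ∀ y ∈ (C₀ : Set X₀), ∃ c : Fin 2 → X₀.presheaf.stalk y,
      IsRsopPart c ∧ Ideal.span (Set.range c) = stalkIdeal (vanishingIdeal C₀) y)
    (hxC₀ : σ x ∈ (C₀ : Set X₀)) (hdim₀ : ringKrullDim (X₀.presheaf.stalk (σ x)) = 3)
    (w : X₀.presheaf.stalk (σ x)) (hw : stalkIdeal (vanishingIdeal C₀) (σ x) ⊔ Ideal.span {w} = maximalIdeal _)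
    (t : Fin 2 → X₀.presheaf.stalk (σ x)) (ht : IsRsopPart t)
    (htP : Ideal.span (Set.range t) = stalkIdeal (vanishingIdeal C₀) (σ x))
    {m : ℕ} (γ s₀ : Fin m → X₀.presheaf.stalk (σ x)) (hγ : ∀ i, IsUnit (γ i))
    (hs₀ : ∀ i, s₀ i ∈ stalkIdeal (vanishingIdeal C₀) (σ x)) (k : Fin m → ℕ) :
    Scheme.IsRegular X ∧
    (∀ y ∈ (C : Set X), ∃ c : Fin 2 → X.presheaf.stalk y, IsRsopPart c ∧ Ideal.span (Set.range c) = stalkIdeal (vanishingIdeal C) y) ∧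
    x ∈ (C : Set X) ∧ ringKrullDim (X.presheaf.stalk x) = 3 ∧
    ∃ e : X.presheaf.stalk x, stalkIdeal (vanishingIdeal C) x ⊔ Ideal.span {e} = maximalIdeal _ ∧
      (∃ tn : Fin 2 → X.presheaf.stalk x, IsRsopPart tn ∧ Ideal.span (Set.range tn) = stalkIdeal (vanishingIdeal C) x ∧
        ∀ j, ∃ c : X.presheaf.stalk x, IsUnit c ∧ (σ.stalkMap x).hom (t j) = c * e ^ n * tn j) ∧
      ∀ i, ∃ (c γ' π' : X.presheaf.stalk x), IsUnit c ∧ IsUnit γ' ∧ π' ∈ stalkIdeal (vanishingIdeal C) x ∧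
        (σ.stalkMap x).hom (γ i * w ^ k i + s₀ i) = c * e ^ min n (k i) * (γ' * e ^ (k i - n) + π') := by
  induction h with
  | nil C₀ x₀ =>
    refine ⟨hX₀, hC₀reg, hxC₀, hdim₀, w, hw, ⟨t, ht, htP, fun j => ⟨1, isUnit_one, ?_⟩⟩,
      fun i => ⟨1, γ i, s₀ i, isUnit_one, hγ i, hs₀ i, ?_⟩⟩
    · rw [Scheme.Hom.stalkMap_id]
      simp only [pow_zero, one_mul]
      rfl
    · rw [Scheme.Hom.stalkMap_id]
      simp only [Nat.zero_min, pow_zero, one_mul, Nat.sub_zero]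
      rfl
  | @cons X X' _ _ σ C₀ C n τ x' hx hchain hYreg hτ hx' ih =>
    -- the induction hypothesis at the previous point `τ x'` (note `(τ ≫ σ) x' = σ (τ x')`)
    obtain ⟨hX, hCreg, hxC, hdim, e, he, ⟨tI, htI, htIP, htimg⟩, hfam⟩ := ih hC₀reg hxC₀ hdim₀ w hw t ht htP γ s₀ hγ hs₀
    -- the data reproduce themselves at `x'`
    obtain ⟨hX', hC'reg, hdim'⟩ := strictTransform_curve_data_of_isBlowup_point hX hx hYreg hτ hCreg hxC hdim hx'
    haveI : IsRegularLocalRing (X'.presheaf.stalk x') := hX' x'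
    have hPle : stalkIdeal (vanishingIdeal C) (τ x') ≤ maximalIdeal _ := le_sup_left.trans he.le
    -- ONE new exceptional coordinate `e'` at `x'`, with `τ^#(e) = v₁ e'`
    obtain ⟨e', he'gen, htr', γ₁, hγ₁, v₁, hv₁, π₁, hπ₁, -, h2⟩ :=
      contact_drop_of_isBlowup_point hX hx hYreg hτ hCreg hxC hdim hx' e 1 1 0 he isUnit_one (Ideal.zero_mem _) 1 le_rfl 1 0
    have heimg : (τ.stalkMap x').hom e = v₁ * e' := by
      simpa using h2
    refine ⟨hX', hC'reg, hx', hdim', e', htr', ?_, fun i => ?_⟩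
    · -- the containing pair
      obtain ⟨e₃, he₃gen, t', ht', ht'P, ht'img⟩ := containing_pair_step hX hx hYreg hτ hCreg hxC hdim hx' tI htIP
      obtain ⟨d, hd, hde⟩ := exists_isUnit_mul_eq_of_span_singleton_eq' (he₃gen.symm.trans he'gen)
      have hspan_d : Ideal.span (Set.range fun j => d * t' j) = Ideal.span (Set.range t') := by
        apply le_antisymm
        · exact Ideal.span_le.mpr (by rintro _ ⟨j, rfl⟩; exact Ideal.mul_mem_left _ _ (Ideal.subset_span ⟨j, rfl⟩))
        · refine Ideal.span_le.mpr ?_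
          rintro _ ⟨j, rfl⟩
          have : t' j = ↑(hd.unit⁻¹) * (d * t' j) := by
            rw [← mul_assoc, IsUnit.val_inv_mul, one_mul]
          rw [this]
          exact Ideal.mul_mem_left _ _ (Ideal.subset_span ⟨j, rfl⟩)
      refine ⟨fun j => d * t' j, isRsopPart_of_span_eq_span ht' ht'P (hspan_d.trans ht'P), hspan_d.trans ht'P, fun j => ?_⟩
      obtain ⟨c, hc, hcimg⟩ := htimg j
      have hcimg' : (σ.stalkMap (τ x')).hom (t j) = c * e ^ n * tI j := hcimg
      refine ⟨(τ.stalkMap x').hom c * v₁ ^ n, (hc.map _).mul (hv₁.pow n), ?_⟩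
      rw [Scheme.Hom.stalkMap_comp]
      change (τ.stalkMap x').hom ((σ.stalkMap (τ x')).hom (t j)) = _
      rw [hcimg', map_mul, map_mul, map_pow, heimg, ht'img j, hde, mul_pow, pow_succ]
      ring
    · -- the transversal family (as in `contact_family_along_pointChain`)
      obtain ⟨c, γ', π', hc, hγ', hπ', hsimg⟩ := hfam i
      have hsimg' : (σ.stalkMap (τ x')).hom (γ i * w ^ k i + s₀ i) = c * e ^ min n (k i) * (γ' * e ^ (k i - n) + π') := hsimg
      by_cases hnk : n < k i
      · have hk1 : 1 ≤ k i - n := by omega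
        obtain ⟨e₂, he₂gen, -, γ₂, hγ₂, v₂, -, π₂, hπ₂, h1, -⟩ :=
          contact_drop_of_isBlowup_point hX hx hYreg hτ hCreg hxC hdim hx' e γ' 1 π' he hγ' hπ' (k i - n) hk1 1 0
        obtain ⟨d, hd, hde⟩ := exists_isUnit_mul_eq_of_span_singleton_eq' (he₂gen.symm.trans he'gen)
        have hmin : min n (k i) = n := Nat.min_eq_left hnk.le
        have hmin' : min (n + 1) (k i) = n + 1 := Nat.min_eq_left (by omega)
        refine ⟨(τ.stalkMap x').hom c * v₁ ^ n * d, γ₂ * d ^ (k i - n - 1), π₂,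
          ((hc.map _).mul (hv₁.pow n)).mul hd, hγ₂.mul (hd.pow _), hπ₂, ?_⟩
        rw [Scheme.Hom.stalkMap_comp]
        change (τ.stalkMap x').hom ((σ.stalkMap (τ x')).hom (γ i * w ^ k i + s₀ i)) = _
        rw [hsimg', map_mul, map_mul, map_pow, heimg, h1, hde, hmin, hmin', show k i - (n + 1) = k i - n - 1 by omega]
        have hsplit : (d * e') ^ (k i - n - 1) = d ^ (k i - n - 1) * e' ^ (k i - n - 1) := mul_pow _ _ _
        rw [hsplit]
        ring
      · have hkn : k i ≤ n := Nat.le_of_not_lt hnk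
        have hmin : min n (k i) = k i := Nat.min_eq_right hkn
        have hmin' : min (n + 1) (k i) = k i := Nat.min_eq_right (by omega)
        have hsub : k i - n = 0 := Nat.sub_eq_zero_of_le hkn
        have hsub' : k i - (n + 1) = 0 := Nat.sub_eq_zero_of_le (by omega)
        have hunit : IsUnit (γ' + π') := by
          by_contra hnu
          have hm : γ' + π' ∈ maximalIdeal (X.presheaf.stalk (τ x')) := (mem_maximalIdeal _).mpr hnu
          have h2' : γ' + π' - π' ∈ maximalIdeal (X.presheaf.stalk (τ x')) := Ideal.sub_mem _ hm (hPle hπ')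
          rw [add_sub_cancel_right] at h2'
          exact (mem_maximalIdeal _).mp h2' hγ'
        refine ⟨(τ.stalkMap x').hom c * v₁ ^ k i, (τ.stalkMap x').hom (γ' + π'), 0,
          (hc.map _).mul (hv₁.pow _), hunit.map _, Ideal.zero_mem _, ?_⟩
        rw [Scheme.Hom.stalkMap_comp]
        change (τ.stalkMap x').hom ((σ.stalkMap (τ x')).hom (γ i * w ^ k i + s₀ i)) = _
        rw [hsimg', hmin, hsub, hmin', hsub', pow_zero, mul_one, pow_zero, mul_one, add_zero, map_mul, map_mul, map_pow, heimg,
          mul_pow]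
        ring

/-- **L7b with clean components containing the curve.**  See the module docstring: at the end point `x` of a chain of `n ≥ max_i k_i`
point blowing ups following the regular curve `C₀`, a representative presented at `x₀ = σ x` as
`u₀ · t₁^{α₁} t₂^{α₂} · ∏_i (γ_i w^{k_i} + s₀ᵢ)^{a_i}` (`(t₁, t₂)` part of a regular system of parameters generating `𝓘_{C₀,x₀}`) becomes
`(unit) · (t₁⁽ⁿ⁾)^{α₁} (t₂⁽ⁿ⁾)^{α₂} · e^{n(α₁+α₂) + Σ_i k_i a_i}` in coordinates adapted to the strict transform `C`, so the line of `σ^♯ G` is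
clean-permissible for `C` at `x` provided some `α_j` is prime to `p` or `p ∤ n(α₁+α₂) + Σ_i k_i a_i`.
[cite: CossartJannsenSaito2020, proof of Thm. 6.28, Step 5] [cite: CossartPiltant2008, Prop. 4.4 (proof, p. 10)]
[cite: BierstoneGrigorievMilmanWlodarczyk2011, Def. 3.1.3 (2)] -/
theorem cleanPermissibleAt_of_pointChain_containing {X₀ X : Scheme.{u}} [IsIntegral X₀] [IsIntegral X] {σ : X ⟶ X₀}
    [IsDominant σ] {C₀ : Closeds X₀} {C : Closeds X} {x : X} {n : ℕ} (h : IsPointChainAlong σ C₀ C x n)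
    [IsLocallyNoetherian X₀] [IsLocallyNoetherian X] (hX₀ : Scheme.IsRegular X₀)
    (hC₀reg : ∀ y ∈ (C₀ : Set X₀), ∃ c : Fin 2 → X₀.presheaf.stalk y,
      IsRsopPart c ∧ Ideal.span (Set.range c) = stalkIdeal (vanishingIdeal C₀) y)
    (hxC₀ : σ x ∈ (C₀ : Set X₀)) (hdim₀ : ringKrullDim (X₀.presheaf.stalk (σ x)) = 3)
    (p : ℕ) (G : X₀.functionField) (cc : Fin p → X₀.functionField) (hcc : ∃ j : Fin p, (j : ℕ) ≠ 0 ∧ cc j ≠ 0)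
    (w u₀ : X₀.presheaf.stalk (σ x)) (hw : stalkIdeal (vanishingIdeal C₀) (σ x) ⊔ Ideal.span {w} = maximalIdeal _)
    (hu₀ : IsUnit u₀) (t : Fin 2 → X₀.presheaf.stalk (σ x)) (ht : IsRsopPart t)
    (htP : Ideal.span (Set.range t) = stalkIdeal (vanishingIdeal C₀) (σ x)) (α : Fin 2 → ℕ)
    {m : ℕ} (γ s₀ : Fin m → X₀.presheaf.stalk (σ x)) (hγ : ∀ i, IsUnit (γ i))
    (hs₀ : ∀ i, s₀ i ∈ stalkIdeal (vanishingIdeal C₀) (σ x)) (k a : Fin m → ℕ) (hkn : ∀ i, k i ≤ n)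
    (hcharge : (∃ j, ¬ p ∣ α j) ∨ ¬ p ∣ (n * ∑ j, α j + ∑ i, k i * a i))
    (hX : (∑ j : Fin p, cc j ^ p * G ^ (j : ℕ)) =
      RatFn.toFunctionField (σ x) (u₀ * (∏ j, t j ^ α j) * ∏ i, (γ i * w ^ k i + s₀ i) ^ a i)) :
    CleanPermissibleAt p (RatFn.toFunctionField x) (RatFn.functionFieldMap σ G) (stalkIdeal (vanishingIdeal C) x) := by
  classical
  obtain ⟨hXreg, hCreg, hxC, hdim, e, he, ⟨tn, htn, htnP, htimg⟩, hfam⟩ :=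
    contact_family_pair_along_pointChain h hX₀ hC₀reg hxC₀ hdim₀ w hw t ht htP γ s₀ hγ hs₀ k
  -- the local rings at `x`
  haveI : IsRegularLocalRing (X.presheaf.stalk x) := hXreg x
  haveI : IsRegularLocalRing (X.presheaf.stalk x ⧸ stalkIdeal (vanishingIdeal C) x) := by
    rw [← htnP]; exact htn.isRegularLocalRing_quotient
  have hP1 : ringKrullDim (X.presheaf.stalk x ⧸ stalkIdeal (vanishingIdeal C) x) = 1 := by
    rw [← htnP]; exact ringKrullDim_quotient_span_pair_eq_one htn hdim
  have hPle : stalkIdeal (vanishingIdeal C) x ≤ maximalIdeal _ := le_sup_left.trans he.le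
  have hem : e ∈ maximalIdeal (X.presheaf.stalk x) := he.le (Ideal.mem_sup_right (Ideal.mem_span_singleton_self e))
  -- per transversal member: `σ^#(s_i) = e^{k_i} · W_i` with `W_i` a unit
  choose c γ' π' hc hγ' hπ' hsimg using hfam
  have hW : ∀ i, IsUnit (c i * (γ' i + π' i)) := by
    intro i
    refine (hc i).mul ?_
    by_contra hnu
    have hm : γ' i + π' i ∈ maximalIdeal (X.presheaf.stalk x) := (mem_maximalIdeal _).mpr hnu
    have h2 : γ' i + π' i - π' i ∈ maximalIdeal (X.presheaf.stalk x) := Ideal.sub_mem _ hm (hPle (hπ' i))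
    rw [add_sub_cancel_right] at h2
    exact (mem_maximalIdeal _).mp h2 (hγ' i)
  have hsimg' : ∀ i, (σ.stalkMap x).hom (γ i * w ^ k i + s₀ i) = (c i * (γ' i + π' i)) * e ^ k i := by
    intro i
    rw [hsimg i, Nat.min_eq_right (hkn i), Nat.sub_eq_zero_of_le (hkn i), pow_zero, mul_one]
    ring
  -- per containing member: `σ^#(t_j) = d_j · e^n · tn_j`
  choose d hd htimg' using htimg
  -- the unit `U` and the adapted presentation upstairs
  set N : ℕ := n * ∑ j, α j + ∑ i, k i * a i with hN
  set U : X.presheaf.stalk x := (σ.stalkMap x).hom u₀ * (∏ j, d j ^ α j) * ∏ i, (c i * (γ' i + π' i)) ^ a i with hU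
  have hUunit : IsUnit U :=
    ((hu₀.map _).mul (IsUnit.prod_univ_iff.mpr fun j => (hd j).pow _)).mul
      (IsUnit.prod_univ_iff.mpr fun i => (hW i).pow _)
  have himg : (σ.stalkMap x).hom (u₀ * (∏ j, t j ^ α j) * ∏ i, (γ i * w ^ k i + s₀ i) ^ a i) =
      U * (∏ j, tn j ^ α j) * e ^ N := by
    rw [map_mul, map_mul, map_prod, map_prod]
    simp only [map_pow, hsimg', htimg', mul_pow, ← pow_mul, Finset.prod_mul_distrib, Finset.prod_pow_eq_pow_sum, hU, hN,
      ← Finset.mul_sum, pow_add]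
    ring
  have hX' : (∑ j : Fin p, (RatFn.functionFieldMap σ (cc j)) ^ p * (RatFn.functionFieldMap σ G) ^ (j : ℕ)) =
      RatFn.toFunctionField x (U * (∏ j, tn j ^ α j) * ∏ l : Fin 1, (![e] : Fin 1 → _) l ^ (![N] : Fin 1 → ℕ) l) := by
    calc (∑ j : Fin p, (RatFn.functionFieldMap σ (cc j)) ^ p * (RatFn.functionFieldMap σ G) ^ (j : ℕ))
        = RatFn.functionFieldMap σ (∑ j : Fin p, cc j ^ p * G ^ (j : ℕ)) := by
          rw [map_sum]; simp only [map_mul, map_pow]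
      _ = RatFn.functionFieldMap σ (RatFn.toFunctionField (σ x) (u₀ * (∏ j, t j ^ α j) * ∏ i, (γ i * w ^ k i + s₀ i) ^ a i)) := by
          rw [hX]
      _ = RatFn.toFunctionField x ((σ.stalkMap x) (u₀ * (∏ j, t j ^ α j) * ∏ i, (γ i * w ^ k i + s₀ i) ^ a i)) :=
          RatFn.functionFieldMap_toFunctionField σ x _
      _ = RatFn.toFunctionField x (U * (∏ j, tn j ^ α j) * e ^ N) := congrArg (RatFn.toFunctionField x) himg
      _ = RatFn.toFunctionField x (U * (∏ j, tn j ^ α j) * ∏ l : Fin 1, (![e] : Fin 1 → _) l ^ (![N] : Fin 1 → ℕ) l) := by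
          simp
  have hcc' : ∃ j : Fin p, (j : ℕ) ≠ 0 ∧ RatFn.functionFieldMap σ (cc j) ≠ 0 := by
    obtain ⟨j, hj, hj0⟩ := hcc
    exact ⟨j, hj, fun h0 => hj0 ((RatFn.functionFieldMap σ).injective (by rw [h0, map_zero]))⟩
  have htnJ : ∀ j, tn j ∈ stalkIdeal (vanishingIdeal C) x := fun j => by
    rw [← htnP]; exact Ideal.subset_span ⟨j, rfl⟩
  have hb := isRsopPart_quotient_singleton_of_sup_span_eq (stalkIdeal (vanishingIdeal C) x) hP1 e he
  refine cleanPermissibleAt_of_split p (RatFn.toFunctionField x) (RatFn.functionFieldMap σ G) _ _ hcc' tn ![e] htn htnJ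
    (fun l => ?_) hb α ![N] ?_ U hUunit hX'
  · fin_cases l; simpa using hem
  · rcases hcharge with ⟨j, hj⟩ | hN'
    · exact Or.inl ⟨j, hj⟩
    · exact Or.inr ⟨0, by simpa [hN] using hN'⟩

end Summit.ResolutionOfSingularities.ResolutionOfSingularities.Theorems.RadicialJung.CleanModels

end
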